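import Mathlib
import Summits.Ventures.PercRepro2.Defs
import Summits.Ventures.PercRepro2.Graph
import Summits.Ventures.PercRepro2.OneColourSwitch
import Summits.Ventures.PercRepro2.RegionHubSign
import Summits.Ventures.PercRepro2.SideSwitch
import Summits.Ventures.PercRepro2.SideSwitchFibre
import Summits.Ventures.PercRepro2.SideSwitchClosed
import Summits.Ventures.PercRepro2.SideSwitchComps
import Summits.Ventures.PercRepro2.SideSwitchCompsFibre
import Summits.Ventures.PercRepro2.TermSwitchDefs
import Summits.Ventures.PercRepro2.TermSwitchFibre
import Summits.Ventures.PercRepro2.TermSwitchCompsFibre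
import Summits.Ventures.PercRepro2.TermSwitchMono
import Summits.Ventures.PercRepro2.TermSwitchM9
import Summits.Ventures.PercRepro2.TermSwitchRestrict
import Summits.Ventures.PercRepro2.TermSwitchReach
import Summits.Ventures.PercRepro2.M9NoPocketDefs
import Summits.Ventures.PercRepro2.M9NoPocketWorld
import Summits.Ventures.PercRepro2.M9NoPocketWorldD
import Summits.Ventures.PercRepro2.M9NoPocketFibre
import Summits.Ventures.PercRepro2.M9PocketUnit
import Summits.Ventures.PercRepro2.M9PocketUnitSum

/-!
# World-set predicates are fibre data of the three-terminal fibration of a unit (blind cell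
PercRepro2, p3 g38, 2026-08-29; `proofs/P3-POCKETRK.md` §8″, kernel plan K3′)

The two vertex sets `K_H ∪ M_H` (the worlds of the terminal set `H = {r, s, d}`) and
`K₂ ∪ M₂` of `G − d` (the worlds of `{r, s}` in the looped graph `endsD`) are constant along the
component assignments of every representative (`UH_assignC_triple`, `U2_endsD_assignC`)
and under the outside flip (`UH_flipOH_triple`, `K2_endsD_flipOH`, `M2_endsD_flipOH`).  Hence
every predicate of the form `F (K_H ∪ M_H) (K₂ ∪ M₂ of G − d)` is fibre data, and the restricted
three-terminal theorem of `TermSwitchRestrict` applies to «`d` reached, in the unit of `ρ₀`, and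
`F`» (`dzeroSignSumHP_unit_worldPred_nonpos`) — in particular to «the `H`-component of a given
block `C₀` of `G − d` meets a vertex reached only through `d`» (the predicate `P₁` of
`proofs/P3-POCKETRK.md` §8″: `∃ x ∈ C₀, ∃ e y, ends e = s(x, y) ∧ y ∈ K_H ∪ M_H ∧ y ∉ H ∧
y ∉ K₂ ∪ M₂ of G − d`) and to its negation, which is what the linking-free-block assembly of
§8″ uses (`(C3-B)`, `(C3-∘)`).  Own work; std axioms.
-/

namespace Summit.Ventures.PercRepro2

namespace NoPocket

open Finset Classical RegionHub OneColourSwitch SideSwitch TermSwitch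

variable {V : Type*} {E : Type*}

section Fibre

variable [Fintype V] [DecidableEq V] [Fintype E] [DecidableEq E] {ends : E → Sym2 V}
  {p q r s d : V}

omit [Fintype E] [DecidableEq E] in
/-- The worlds of the terminal set `{r, s, d}` (as a set) are preserved by the component
assignments of a representative. -/
lemma UH_assignC_triple {T : Finset (Finset V)} {ρ : Config E}
    (hT : T ⊆ compsH ends ({r, s, d} : Set V) ρ) :
    KH ends ({r, s, d} : Set V) (assignC ends T ρ) ∪
        MH ends ({r, s, d} : Set V) (assignC ends T ρ) =
      KH ends ({r, s, d} : Set V) ρ ∪ MH ends ({r, s, d} : Set V) ρ := by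
  obtain ⟨_, h2, h3⟩ := switch_data_unionT_H hT
  exact UH_flipTouch_of_closed h2 h3

omit [Fintype V] [DecidableEq V] [Fintype E] [DecidableEq E] in
/-- The worlds of the terminal set `{r, s, d}` (as a set) are preserved by the outside flip. -/
lemma UH_flipOH_triple (ρ : Config E) :
    KH ends ({r, s, d} : Set V) (flipOH ends ({r, s, d} : Set V) ρ) ∪
        MH ends ({r, s, d} : Set V) (flipOH ends ({r, s, d} : Set V) ρ) =
      KH ends ({r, s, d} : Set V) ρ ∪ MH ends ({r, s, d} : Set V) ρ := by
  simp only [flipOH, KH_flipIn_OsetH, MH_flipIn_OsetH]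

/-- **A world-set predicate is constant along the component assignments of a representative.** -/
theorem worldPred_assignC_iff (F : Set V → Set V → Prop) {T : Finset (Finset V)}
    (hr : d ≠ r) (hs : d ≠ s) {ρ : Config E} (hρ : ρ ∈ RepH ends p q ({r, s, d} : Set V))
    (hT : T ⊆ compsH ends ({r, s, d} : Set V) ρ) :
    F (KH ends ({r, s, d} : Set V) (assignC ends T ρ) ∪
        MH ends ({r, s, d} : Set V) (assignC ends T ρ))
      (K2 (endsD ends d) r s (assignC ends T ρ) ∪ M2 (endsD ends d) r s (assignC ends T ρ)) ↔
    F (KH ends ({r, s, d} : Set V) ρ ∪ MH ends ({r, s, d} : Set V) ρ)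
      (K2 (endsD ends d) r s ρ ∪ M2 (endsD ends d) r s ρ) := by
  rw [UH_assignC_triple hT, U2_endsD_assignC hr hs hρ hT]

omit [Fintype V] [DecidableEq V] [Fintype E] [DecidableEq E] in
/-- **A world-set predicate is invariant under the outside flip.** -/
theorem worldPred_flipOH_iff (F : Set V → Set V → Prop) (hr : d ≠ r) (hs : d ≠ s)
    (ρ : Config E) :
    F (KH ends ({r, s, d} : Set V) (flipOH ends ({r, s, d} : Set V) ρ) ∪
        MH ends ({r, s, d} : Set V) (flipOH ends ({r, s, d} : Set V) ρ))
      (K2 (endsD ends d) r s (flipOH ends ({r, s, d} : Set V) ρ) ∪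
        M2 (endsD ends d) r s (flipOH ends ({r, s, d} : Set V) ρ)) ↔
    F (KH ends ({r, s, d} : Set V) ρ ∪ MH ends ({r, s, d} : Set V) ρ)
      (K2 (endsD ends d) r s ρ ∪ M2 (endsD ends d) r s ρ) := by
  rw [UH_flipOH_triple, K2_endsD_flipOH hr hs, M2_endsD_flipOH hr hs]

/-- **The three-terminal sum over the `L`-class of a unit restricted by a world-set predicate is
non-positive**: for every colouring `ρ₀` and every `F : Set V → Set V → Prop`,
`Σ_{ω ∈ Sep₃ ∩ DZero₃, d reached, ω in the unit of ρ₀, F (K_H ∪ M_H) (K₂ ∪ M₂ of G − d)}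
σ_pq · σ_rs ≤ 0`. -/
theorem dzeroSignSumHP_unit_worldPred_nonpos (p q : V) (hrd : r ≠ d) (hsd : s ≠ d)
    (ρ₀ : Config E) (F : Set V → Set V → Prop) :
    dzeroSignSumHP ends p q r s ({r, s, d} : Set V)
      (fun ω => Reached ends r s d ω ∧
        (∀ e ∈ touches (endsD ends d) (K2 (endsD ends d) r s ω ∪ M2 (endsD ends d) r s ω),
          nu (endsD ends d) r s ω e = ρ₀ e) ∧
        F (KH ends ({r, s, d} : Set V) ω ∪ MH ends ({r, s, d} : Set V) ω)
          (K2 (endsD ends d) r s ω ∪ M2 (endsD ends d) r s ω)) ≤ 0 :=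
  dzeroSignSumHP_nonpos p q s (r_mem_triple r s d) _
    (fun _ hρ _ hT => and_congr (reached_assignC_iff hrd hsd hT)
      (and_congr (unit_assignC_iff hrd.symm hsd.symm ρ₀ hρ hT)
        (worldPred_assignC_iff F hrd.symm hsd.symm hρ hT)))
    (fun ρ hρ => and_congr (reached_flipOH_iff ρ)
      (and_congr (unit_flipOH_iff hrd.symm hsd.symm ρ₀ hρ)
        (worldPred_flipOH_iff F hrd.symm hsd.symm ρ)))

/-- The predicate `P₁` of `proofs/P3-POCKETRK.md` §8″ for a block `C₀`: the `H`-component of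
`C₀` contains a vertex reached from `{r, s, d}` but not from `{r, s}` in `G − d` — stated as a
world-set predicate. -/
theorem dzeroSignSumHP_unit_componentTouch_nonpos (p q : V) (hrd : r ≠ d) (hsd : s ≠ d)
    (ρ₀ : Config E) (C₀ : Set V) :
    dzeroSignSumHP ends p q r s ({r, s, d} : Set V)
      (fun ω => Reached ends r s d ω ∧
        (∀ e ∈ touches (endsD ends d) (K2 (endsD ends d) r s ω ∪ M2 (endsD ends d) r s ω),
          nu (endsD ends d) r s ω e = ρ₀ e) ∧
        ∃ x ∈ C₀, ∃ e, ∃ y, ends e = s(x, y) ∧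
          y ∈ KH ends ({r, s, d} : Set V) ω ∪ MH ends ({r, s, d} : Set V) ω ∧
          y ∉ ({r, s, d} : Set V) ∧
          y ∉ K2 (endsD ends d) r s ω ∪ M2 (endsD ends d) r s ω) ≤ 0 :=
  dzeroSignSumHP_unit_worldPred_nonpos p q hrd hsd ρ₀
    (fun UH U2 => ∃ x ∈ C₀, ∃ e, ∃ y, ends e = s(x, y) ∧ y ∈ UH ∧ y ∉ ({r, s, d} : Set V) ∧
      y ∉ U2)

/-- The complementary restriction (`¬ P₁`). -/
theorem dzeroSignSumHP_unit_componentTouch_not_nonpos (p q : V) (hrd : r ≠ d) (hsd : s ≠ d)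
    (ρ₀ : Config E) (C₀ : Set V) :
    dzeroSignSumHP ends p q r s ({r, s, d} : Set V)
      (fun ω => Reached ends r s d ω ∧
        (∀ e ∈ touches (endsD ends d) (K2 (endsD ends d) r s ω ∪ M2 (endsD ends d) r s ω),
          nu (endsD ends d) r s ω e = ρ₀ e) ∧
        ¬ ∃ x ∈ C₀, ∃ e, ∃ y, ends e = s(x, y) ∧
          y ∈ KH ends ({r, s, d} : Set V) ω ∪ MH ends ({r, s, d} : Set V) ω ∧
          y ∉ ({r, s, d} : Set V) ∧
          y ∉ K2 (endsD ends d) r s ω ∪ M2 (endsD ends d) r s ω) ≤ 0 :=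
  dzeroSignSumHP_unit_worldPred_nonpos p q hrd hsd ρ₀
    (fun UH U2 => ¬ ∃ x ∈ C₀, ∃ e, ∃ y, ends e = s(x, y) ∧ y ∈ UH ∧
      y ∉ ({r, s, d} : Set V) ∧ y ∉ U2)

end Fibre

end NoPocket

end Summit.Ventures.PercRepro2
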